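import Summits.Ventures.DiscreteObjects.PP12.FlagTenDataFin
import Summits.Ventures.DiscreteObjects.PP12.FlagTenFibres
import Summits.Ventures.DiscreteObjects.PP12.FlagTenGammaSeparates

/-!
# `IsFlagTenOrbitMatrix` for the data of a plane: conjuncts 2 and 3 (`γ j` and `C k` are triangle colourings) (kernel; Step E transport)
Framing: lottery ticket; floor = certified bounds/negative ranges.

Cell pub-namedobj (venture DiscreteObjects), target (M), designs gen 13 (HOME FAMILY-FLAG7X §7/§7b). For `D = flagTenDataOfPlane …`
(`FlagTenDataFin`): `IsTriangleColouring D.φ (D.γ j)` and `IsTriangleColouring D.φ (D.C k)` for all `j, k` — transported from the subtype-level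
facts `card_gammaOrb_fibre`, `gammaOrb_phiVertex_ne` (`FlagTenFibres`, `FlagTenGammaSeparates`) and `card_cOrb_fibre`, `cOrb_phiVertex_ne`
(`FlagTenFibres`, `FlagTenCSeparates`). Together with `flagTenDataOfPlane_phi` and `flagTenDataOfPlane_beta_bijective` this gives conjuncts 1–4
of `IsFlagTenOrbitMatrix (flagTenDataOfPlane …)`; the six λ = 1 conjuncts 5–10 remain (FAMILY-FLAG7X §7b). No `sorry`, no new axioms.
-/

namespace Summit.Ventures.DiscreteObjects.PP12

open Configuration Finset
open scoped Classical

namespace Collineation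

variable {P L : Type*} [Membership P L] [ProjectivePlane P L] [Fintype P] [Fintype L] (σ : Collineation P L)

section Data

variable {l : L} {c : P} (hl : σ.onLines l = l) (hc : σ.onPoints c = c) (hcl : c ∈ l)
  (hP : ∀ p : P, σ.onPoints p = p → p ∈ l) (hL : ∀ m : L, σ.onLines m = m → c ∈ m) (h12 : ProjectivePlane.order P L = 12)
  (hq : σ.onPoints ^ 3 = 1) (hf : fixedCard σ.onPoints = 10) {u₀ : L} (hcu₀ : c ∈ u₀) (hu₀ : σ.onLines u₀ ≠ u₀)

/-- Transport of a fibre count along `eTri`: a `Fin 12`-filter defined through `(eTri i).1` has the cardinality of the corresponding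
filter of points `≠ c` of `u₀`. -/
theorem card_filter_eTri (p : P → Prop) :
    (univ.filter fun i : Fin 12 => p (eTri (P := P) h12 hcu₀ i).1).card = (univ.filter fun x : P => x ∈ u₀ ∧ x ≠ c ∧ p x).card := by
  set e := eTri (P := P) h12 hcu₀
  refine Finset.card_bij (fun i _ => (e i).1) (fun i hi => ?_) (fun i₁ _ i₂ _ h => ?_) (fun x hx => ?_)
  · rw [mem_filter] at hi ⊢; exact ⟨mem_univ _, (e i).2.1, (e i).2.2, hi.2⟩
  · exact e.injective (Subtype.ext h)
  · rw [mem_filter] at hx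
    refine ⟨e.symm ⟨x, hx.2.1, hx.2.2.1⟩, ?_, ?_⟩
    · rw [mem_filter]; refine ⟨mem_univ _, ?_⟩; rw [Equiv.apply_symm_apply]; exact hx.2.2.2
    · rw [Equiv.apply_symm_apply]

/-- **Conjunct 2:** every `γ j` is a triangle colouring for `φ`. -/
theorem flagTenDataOfPlane_gamma (j : Fin 9) :
    IsTriangleColouring (σ.flagTenDataOfPlane hl hc hcl hP hL h12 hq hf hcu₀ hu₀).φ
      ((σ.flagTenDataOfPlane hl hc hcl hP hL h12 hq hf hcu₀ hu₀).γ j) := by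
  set D := σ.flagTenDataOfPlane hl hc hcl hP hL h12 hq hf hcu₀ hu₀ with hD
  set e := eTri (P := P) h12 hcu₀ with he
  set m := σ.eFixL hl hc hf j with hm
  set eO := σ.eOrbOn hc hcl hP hL h12 hq m with heO
  have hγ : ∀ i : Fin 12, D.γ j i = eO.symm ⟨σ.gammaOrb l c m.1 (e i).1,
      (σ.gammaOrb_mem hl hc hP hL (σ.exterior_of_mem_cline hL hcu₀ hu₀ (e i).2.1 (e i).2.2) m.2.1).1⟩ := fun i => rfl
  have hφ : ∀ i : Fin 12, (e (D.φ i)).1 = σ.phiVertex l c u₀ (e i).1 := by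
    intro i
    change (e ((((e.trans (σ.phiEquiv hl hc hcl hP hL h12 hq hf hcu₀ hu₀)).trans e.symm)) i)).1 = _
    simp only [Equiv.trans_apply, Equiv.apply_symm_apply]
    rfl
  constructor
  · intro t
    -- the fibre of t ↔ the triangles x with gammaOrb m x = (eO t)
    have hset : (univ.filter fun i : Fin 12 => D.γ j i = t) = univ.filter fun i : Fin 12 => σ.gammaOrb l c m.1 (e i).1 = (eO t).1 := by
      ext i; simp only [mem_filter, mem_univ, true_and, hγ]
      constructor
      · intro h; have := congrArg (fun s => (eO s).1) h; simpa using this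
      · intro h; apply eO.injective; rw [Equiv.apply_symm_apply]; exact Subtype.ext h
    rw [hset]
    have h1 := card_filter_eTri h12 hcu₀ (fun x => σ.gammaOrb l c m.1 x = (eO t).1)
    rw [← he] at h1
    have h2 := σ.card_gammaOrb_fibre hl hc hcl hP hL h12 hq hf hcu₀ hu₀ m.2.1 m.2.2 (eO t).2
    have h4 : (univ.filter fun x : P => x ∈ u₀ ∧ x ≠ c ∧ σ.gammaOrb l c m.1 x = (eO t).1).card = 3 := by convert h2 using 2
    rw [← h4]
    convert h1 using 2 <;> (ext x; simp only [mem_filter, mem_univ, true_and])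
  · intro i h
    rw [hγ, hγ] at h
    have := congrArg Subtype.val (eO.symm.injective h)
    simp only at this
    rw [hφ] at this
    exact σ.gammaOrb_phiVertex_ne hl hc hcl hP hL h12 hq hf hcu₀ hu₀ (e i).2.1 (e i).2.2 m.2.1 m.2.2 this

/-- **Conjunct 3:** every `C k` is a triangle colouring for `φ`. -/
theorem flagTenDataOfPlane_C (k : Fin 9) :
    IsTriangleColouring (σ.flagTenDataOfPlane hl hc hcl hP hL h12 hq hf hcu₀ hu₀).φ
      ((σ.flagTenDataOfPlane hl hc hcl hP hL h12 hq hf hcu₀ hu₀).C k) := by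
  set D := σ.flagTenDataOfPlane hl hc hcl hP hL h12 hq hf hcu₀ hu₀ with hD
  set e := eTri (P := P) h12 hcu₀ with he
  set y := σ.eFixP hl hc hf k with hy
  set eB := σ.eLOrb hl hcl hP hL h12 hq y with heB
  have hC : ∀ i : Fin 12, D.C k i = eB.symm ⟨σ.cOrb l y.1 (e i).1,
      (σ.cOrb_mem hl hP (σ.exterior_of_mem_cline hL hcu₀ hu₀ (e i).2.1 (e i).2.2) y.2.1).1⟩ := fun i => rfl
  have hφ : ∀ i : Fin 12, (e (D.φ i)).1 = σ.phiVertex l c u₀ (e i).1 := by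
    intro i
    change (e ((((e.trans (σ.phiEquiv hl hc hcl hP hL h12 hq hf hcu₀ hu₀)).trans e.symm)) i)).1 = _
    simp only [Equiv.trans_apply, Equiv.apply_symm_apply]
    rfl
  constructor
  · intro t
    -- (eB t).1 is the orbit of some T-line b through y
    obtain ⟨b, hb, hbeq⟩ := mem_image.1 (eB t).2
    rw [mem_filter] at hb
    have hset : (univ.filter fun i : Fin 12 => D.C k i = t) = univ.filter fun i : Fin 12 => σ.cOrb l y.1 (e i).1 = orb3 σ.onLines b := by
      ext i; simp only [mem_filter, mem_univ, true_and, hC]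
      constructor
      · intro h; have := congrArg (fun s => (eB s).1) h; simp at this; rw [this, hbeq]
      · intro h; apply eB.injective; rw [Equiv.apply_symm_apply]; apply Subtype.ext; change σ.cOrb l y.1 (e i).1 = (eB t).1; rw [h, hbeq]
    rw [hset]
    have h1 := card_filter_eTri h12 hcu₀ (fun x => σ.cOrb l y.1 x = orb3 σ.onLines b)
    rw [← he] at h1
    have h2 := σ.card_cOrb_fibre hl hc hcl hP hL h12 hq hf hcu₀ hu₀ y.2.1 y.2.2 hb.2.1 hb.2.2
    have h4 : (univ.filter fun x : P => x ∈ u₀ ∧ x ≠ c ∧ σ.cOrb l y.1 x = orb3 σ.onLines b).card = 3 := by convert h2 using 2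
    rw [← h4]
    convert h1 using 2 <;> (ext x; simp only [mem_filter, mem_univ, true_and])
  · intro i h
    rw [hC, hC] at h
    have := congrArg Subtype.val (eB.symm.injective h)
    simp only at this
    rw [hφ] at this
    exact σ.cOrb_phiVertex_ne hl hc hcl hP hL h12 hq hf hcu₀ hu₀ (e i).2.1 (e i).2.2 y.2.1 y.2.2 this

end Data

end Collineation

end Summit.Ventures.DiscreteObjects.PP12
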